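import Literature.NumberTheory.Automorphic.IdelicDyadicUnfolding
import Literature.NumberTheory.Automorphic.IdeleClassGroupCompactProofs
import Literature.NumberTheory.Automorphic.AdelicFundamentalDomain
import HarnessLib

/-!
# Reduction of a sup over `𝔸_F × 𝔸_Eˣ` to a compact set times a ray, from `F`- and `Eˣ`-invariance
# (Weil, *Sur la formule de Siegel* (1965), n° 50, proof of Thm 4, (39)–(40): «il suffit de faire varier … dans un compact»)

Topic `NumberTheory/Automorphic`; namespace `Literature.NumberTheory.Automorphic`.  KERNEL ONLY (theorems; no definition, no named fact).

The endgame of Weil's Theorem 4 [Weil1965, n° 50 pp. 72–74] bounds `E''(t(q_β) d(t) Ψ)` over all chirps `β ∈ 𝔸_F` and dilations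
`t ∈ 𝔸_Eˣ` by first reducing, through the invariance of `E''` under the RATIONAL chirps `t(q_b)`, `b ∈ F`, and the rational dilations
`d(τ)`, `τ ∈ Eˣ`, to `β` in a compact fundamental set of `𝔸_F ∕ F` and `t` in (compact) × (archimedean ray) — [WeilBNT1967, Ch. IV §4 Thm 6:
`𝕀_E = Eˣ · 𝕀_E¹-compact-part · z(ℝ_{>0})`].  This file supplies exactly that reduction, in three pieces over the tree's idele∕adele currency:

* §1 `exists_isCompact_normOneIdeles_subset` — a COMPACT `C ⊆ 𝕀_E` with `𝕀_E¹ ⊆ Eˣ · C` (compactness of `C_E¹ = 𝕀_E¹ ∕ Eˣ`, ★ `IdeleClassGroup.isCompact_normOne_holds`,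
  lifted along the open quotient map of the locally compact `𝕀_E`, open quotient map + finite subcover);
  `exists_isCompact_idele_decomposition` — `∀ t, t = q · c · z(r)` with `q ∈ Eˣ`, `c ∈ C`, `r > 0` (★ `exists_normOneIdeles_mul_posRealIdele`);
* §2 `exists_isCompact_adele_decomposition` — a COMPACT `K_F ⊆ 𝔸_F` with `∀ β, β = b + β'`, `b ∈ F`, `β' ∈ K_F` (Tate's fundamental domain,
  ★ `existsUnique_add_algebraMap_mem_adeleFundamentalDomain`, ★ `exists_isCompact_adeleFundamentalDomain_subset`);
* §3 `forall_of_forall_compact_ray` — the ABSTRACT REDUCTION: for any `f : 𝔸_F → 𝕀_E → α` invariant under `β ↦ b + β` (`b ∈ F`) and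
  «`Eˣ`-equivariant» (`∀ q ∈ Eˣ, ∀ β t, ∃ β', f β (q t) = f β' t`), a property holding on `K_F × (C · z(ℝ_{>0}))` holds everywhere.

## References
* [Weil1965] A. Weil, *Sur la formule de Siegel dans la théorie des groupes classiques*, Acta Math. 113 (1965), n° 50 pp. 72–74.
* [WeilBNT1967] A. Weil, *Basic Number Theory* (1967), Ch. IV §4, Thm 6 and Cor. 2 of Thm 5.
* [CasselsFrohlichANT1967] J. W. S. Cassels, *Global fields*, in Cassels–Fröhlich (1967), Ch. II §16.
-/

noncomputable section

open scoped NNReal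
open NumberField Topology
open scoped Pointwise

namespace Literature.NumberTheory.Automorphic

/-! ## §1 Ideles: `𝕀_E = Eˣ · C · z(ℝ_{>0})` with `C` compact -/

section Idele

variable (E : Type) [Field E] [NumberField E]

/-- **Compact subsets of `G ⧸ H` lift**: every compact `K ⊆ G ⧸ H` is contained in the image of a compact subset of the locally
compact group `G` (the quotient map is open; finitely many translates of a compact neighbourhood of `1`). [folklore] -/
private theorem exists_isCompact_subset_image_mk' {G : Type*} [Group G] [TopologicalSpace G] [IsTopologicalGroup G]
    [LocallyCompactSpace G] (H : Subgroup G) {K : Set (G ⧸ H)} (hK : IsCompact K) :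
    ∃ A : Set G, IsCompact A ∧ K ⊆ QuotientGroup.mk '' A := by
  obtain ⟨V, hVc, hV1⟩ := exists_compact_mem_nhds (1 : G)
  have h1 : (1 : G) ∈ interior V := mem_interior_iff_mem_nhds.2 hV1
  have hcover : K ⊆ ⋃ x : G, QuotientGroup.mk '' (x • interior V) := by
    intro q _
    induction q using QuotientGroup.induction_on with
    | H x => exact Set.mem_iUnion.2 ⟨x, x, ⟨1, h1, mul_one x⟩, rfl⟩
  have hopen : ∀ x : G, IsOpen (QuotientGroup.mk '' (x • interior V) : Set (G ⧸ H)) :=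
    fun x => QuotientGroup.isOpenMap_coe _ (isOpen_interior.smul x)
  obtain ⟨t, ht⟩ := hK.elim_finite_subcover _ hopen hcover
  refine ⟨⋃ x ∈ t, x • V, t.isCompact_biUnion fun x _ => hVc.smul x, fun q hq => ?_⟩
  obtain ⟨x, hxt, y, hy, rfl⟩ : ∃ x ∈ t, q ∈ QuotientGroup.mk '' (x • interior V) := by
    simpa only [Set.mem_iUnion, exists_prop] using ht hq
  exact ⟨y, Set.mem_iUnion₂.2 ⟨x, hxt, Set.smul_set_mono interior_subset hy⟩, rfl⟩

/-- **a compact `C ⊆ 𝕀_E` with `𝕀_E¹ ⊆ Eˣ · C`** — the compact group `C_E¹ = 𝕀_E¹ ∕ Eˣ` lifts to a compact subset of the locally compact `𝕀_E`.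
[cite: WeilBNT1967, Ch. IV §4 Thm 6] [cite: CasselsFrohlichANT1967, Ch. II §16] -/
theorem exists_isCompact_normOneIdeles_subset :
    ∃ C : Set (GaloisRepresentations.ideleGroup E), IsCompact C ∧
      ∀ x ∈ normOneIdeles E, ∃ q ∈ GaloisRepresentations.principalIdeles E, ∃ c ∈ C, x = q * c := by
  haveI := locallyCompactSpace_ideleGroup E
  obtain ⟨C, hC, hsub⟩ := exists_isCompact_subset_image_mk' (GaloisRepresentations.principalIdeles E)
    (IdeleClassGroup.isCompact_normOne_holds E)
  refine ⟨C, hC, fun x hx => ?_⟩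
  have hmem : (QuotientGroup.mk x : IdeleClassGroup E) ∈ (IdeleClassGroup.normOne E : Set (IdeleClassGroup E)) :=
    Subgroup.mem_map_of_mem _ hx
  obtain ⟨c, hcC, hcx⟩ := hsub hmem
  refine ⟨x * c⁻¹, ?_, c, hcC, (inv_mul_cancel_right x c).symm⟩
  have h := QuotientGroup.eq.1 hcx
  -- `c⁻¹ * x ∈ Eˣ`; the idele group is commutative
  rwa [mul_comm] at h

/-- **`t = q · c · z(r)`** for every idele `t`: `q ∈ Eˣ`, `c` in the compact `C` of `exists_isCompact_normOneIdeles_subset`, `z(r)` the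
archimedean positive scalar idele (★ `posRealIdele`). [cite: WeilBNT1967, Ch. IV §4 Cor. 2 of Thm 5 and Thm 6] -/
theorem exists_isCompact_idele_decomposition :
    ∃ C : Set (GaloisRepresentations.ideleGroup E), IsCompact C ∧
      ∀ t : GaloisRepresentations.ideleGroup E, ∃ q ∈ GaloisRepresentations.principalIdeles E, ∃ c ∈ C, ∃ r : ℝ≥0ˣ,
        t = q * c * posRealIdele E r := by
  obtain ⟨C, hC, hdec⟩ := exists_isCompact_normOneIdeles_subset E
  refine ⟨C, hC, fun t => ?_⟩
  obtain ⟨y, hy, r, hty⟩ := exists_normOneIdeles_mul_posRealIdele (K := E) t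
  obtain ⟨q, hq, c, hc, hyc⟩ := hdec y hy
  exact ⟨q, hq, c, hc, r, by rw [hty, hyc]⟩

end Idele

/-! ## §2 Adeles: `𝔸_F = F + K_F` with `K_F` compact -/

section Adele

variable (F : Type*) [Field F] [NumberField F]

/-- **a compact `K_F ⊆ 𝔸_F` with `𝔸_F = F + K_F`** (Tate's fundamental domain is relatively compact). [cite: CasselsFrohlichANT1967, Ch. II §14–16] -/
theorem exists_isCompact_adele_decomposition :
    ∃ KF : Set (AdeleRing (𝓞 F) F), IsCompact KF ∧
      ∀ β : AdeleRing (𝓞 F) F, ∃ b : F, ∃ β' ∈ KF, β = algebraMap F (AdeleRing (𝓞 F) F) b + β' := by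
  obtain ⟨C, hC, -, hDC⟩ := exists_isCompact_adeleFundamentalDomain_subset (K := F)
  refine ⟨C, hC, fun β => ?_⟩
  obtain ⟨ξ, hξ, -⟩ := existsUnique_add_algebraMap_mem_adeleFundamentalDomain (K := F) β
  refine ⟨-ξ, algebraMap F (AdeleRing (𝓞 F) F) ξ + β, hDC hξ, ?_⟩
  rw [map_neg, neg_add_cancel_left]

end Adele

/-! ## §3 The abstract reduction -/

section Reduction

variable {F : Type*} [Field F] [NumberField F] {E : Type} [Field E] [NumberField E] {α : Sort*}

/-- **THE REDUCTION** [Weil1965 n° 50]: let `f : 𝔸_F → 𝕀_E → α` be invariant under the rational chirps (`f (b + β) t = f β t`, `b ∈ F`) and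
«equivariant» under the rational dilations (`∀ q ∈ Eˣ, ∀ β t, ∃ β', f β (q t) = f β' t`); if a property `P` holds for `f β' (c · z(r))` for all `β'`
in a set `K_F` with `𝔸_F = F + K_F`, all `c` in a set `C` with `𝕀_E = Eˣ · C · z(ℝ_{>0})`, and all `r > 0`, then `P (f β t)` for ALL `β`, `t`.
[cite: Weil1965, n° 50 pp. 72–74] -/
theorem forall_of_forall_compact_ray (P : α → Prop) (f : AdeleRing (𝓞 F) F → GaloisRepresentations.ideleGroup E → α)
    {KF : Set (AdeleRing (𝓞 F) F)} (hKF : ∀ β : AdeleRing (𝓞 F) F, ∃ b : F, ∃ β' ∈ KF, β = algebraMap F (AdeleRing (𝓞 F) F) b + β')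
    {C : Set (GaloisRepresentations.ideleGroup E)}
    (hC : ∀ t : GaloisRepresentations.ideleGroup E, ∃ q ∈ GaloisRepresentations.principalIdeles E, ∃ c ∈ C, ∃ r : ℝ≥0ˣ,
      t = q * c * posRealIdele E r)
    (hF : ∀ (b : F) (β : AdeleRing (𝓞 F) F) (t : GaloisRepresentations.ideleGroup E),
      f (algebraMap F (AdeleRing (𝓞 F) F) b + β) t = f β t)
    (hE : ∀ q ∈ GaloisRepresentations.principalIdeles E, ∀ (β : AdeleRing (𝓞 F) F) (t : GaloisRepresentations.ideleGroup E),
      ∃ β' : AdeleRing (𝓞 F) F, f β (q * t) = f β' t)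
    (hP : ∀ β' ∈ KF, ∀ c ∈ C, ∀ r : ℝ≥0ˣ, P (f β' (c * posRealIdele E r))) :
    ∀ (β : AdeleRing (𝓞 F) F) (t : GaloisRepresentations.ideleGroup E), P (f β t) := by
  intro β t
  obtain ⟨q, hq, c, hc, r, rfl⟩ := hC t
  obtain ⟨β₁, h₁⟩ := hE q hq β (c * posRealIdele E r)
  obtain ⟨b, β', hβ', rfl⟩ := hKF β₁
  rw [mul_assoc, h₁, hF]
  exact hP β' hβ' c hc r

/-- **the packaged form**: there EXIST compact `K_F ⊆ 𝔸_F` and `C ⊆ 𝕀_E` such that, for every `f` as above, `P` on `K_F × C · z(ℝ_{>0})` gives `P`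
everywhere (§1 + §2 + `forall_of_forall_compact_ray`). [cite: Weil1965, n° 50 pp. 72–74] [cite: WeilBNT1967, Ch. IV §4 Thm 6] -/
theorem exists_isCompact_sup_reduction (F : Type*) [Field F] [NumberField F] (E : Type) [Field E] [NumberField E] :
    ∃ (KF : Set (AdeleRing (𝓞 F) F)) (C : Set (GaloisRepresentations.ideleGroup E)), IsCompact KF ∧ IsCompact C ∧
      ∀ {α : Sort*} (P : α → Prop) (f : AdeleRing (𝓞 F) F → GaloisRepresentations.ideleGroup E → α),
        (∀ (b : F) (β : AdeleRing (𝓞 F) F) (t : GaloisRepresentations.ideleGroup E), f (algebraMap F (AdeleRing (𝓞 F) F) b + β) t = f β t) →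
        (∀ q ∈ GaloisRepresentations.principalIdeles E, ∀ (β : AdeleRing (𝓞 F) F) (t : GaloisRepresentations.ideleGroup E),
          ∃ β' : AdeleRing (𝓞 F) F, f β (q * t) = f β' t) →
        (∀ β' ∈ KF, ∀ c ∈ C, ∀ r : ℝ≥0ˣ, P (f β' (c * posRealIdele E r))) →
        ∀ (β : AdeleRing (𝓞 F) F) (t : GaloisRepresentations.ideleGroup E), P (f β t) := by
  obtain ⟨KF, hKF, hKFdec⟩ := exists_isCompact_adele_decomposition F
  obtain ⟨C, hC, hCdec⟩ := exists_isCompact_idele_decomposition E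
  exact ⟨KF, C, hKF, hC, fun P f hF hE hP => forall_of_forall_compact_ray P f hKFdec hCdec hF hE hP⟩

end Reduction

end Literature.NumberTheory.Automorphic

end
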